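import Summits.CriticalPhenomena.PercolationContinuityZ3.Theorems.PercNearOneGluingNoHeavyLowerTailThreePointProductFormTreeRecursion
import Mathlib.Tactic.LinearCombination
import HarnessLib

/-!
# Tight pieces: the equality case `#P1 = #P2 = #bad` of the product form on trees, and hub caterpillars
# (Sahi programme, prover prim-sahi-p2 gen 63)

Support file (`--supports stmt-CriticalPhenomena-4575`, helper).  Standard axioms, no sorries, no named facts, no definitions.  Memo
`run/shared/lean/prim/prim-sahi/FROM-prim-sahi-p2-gen63-HUB-WORDS.md` §2, `prim-sahi-p2/PROOF-E3.md` §73 (73b).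

Variables of the tree recursion (`…ThreePointProductFormTreeRecursion`): for the sub-instance at a tree vertex `v`,
`r = #S0`, `p = #P1 + #S0`, `q = #P2 + #S0`, `g = #good = #S0 − #bad`; a child `u` enters its parent through the 4-vector
`(a,b,d,n) = (p−r, q−r, r−g, r+g) = (#P1, #P2, #bad, 2#S0 − #bad)`; unmarked vertex: `r_v = ∏(p+q)`, `p_v = ∏(2p+q−r)`,
`q_v = ∏(p+2q−r)`, `g_v = ∏(p+g) + ∏(q+g) − ∏(r+g)`.
Call a child TIGHT if `#P1 = #P2 = #bad`, i.e. `p = q = 2r − g` (examples: the symmetric pendant hub `z ~ y, s, c`: `(r,p,q,g) = (1,2,2,0)`;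
a bare subtree: `p = q = r = g`).  Writing `x = p − r (= #P1)` and `n = r + g` for a tight child (so `p + q = n + 3x`, `2p+q−r = n+4x`,
`p + g = n + x`):
* `tight_children_p_eq_q` — if all children of an unmarked vertex are tight then `p_v = q_v` (`#P1 = #P2`).
* **`gap_prod_nonneg`** [this work] — for reals `n_u, x_u ≥ 0` over any `Finset`,
  `∏(n+4x) − 2∏(n+3x) + 2∏(n+x) − ∏ n ≥ 0`; this is `#P1 − #bad` of an unmarked vertex all of whose children are tight
  (`tight_children_gap_eq`), so such a vertex satisfies the AM form `#bad ≤ #P1 = #P2` with the explicit gap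
  `∑_{S ≠ ∅} (4^{|S|} − 2·3^{|S|} + 2) ∏_{u∈S} x_u ∏_{u∉S} n_u` (coefficients `0, 0, 12, 110, …`).
* **`tight_of_two_children`**, `tight_of_one_child` [this work] — with at most two children (both tight) the gap vanishes: the vertex is
  again tight.  Hence (`tight_of_caterpillarRecursion`) on every rooted tree in which each vertex has at most two children and the leaves'
  data are tight — e.g. the apex `a` with two pendant paths ("arms") whose vertices each carry at most one symmetric hub — the
  recursion gives `p = q = 2r − g`, i.e. `#P1 = #P2 = #bad`, at every vertex: these instances are TIGHT for (P).
Used in the memo's THEOREM A (bare vertices are invisible to `#P1 − #bad` of a hub-decorated cycle): inserting a bare vertex into a cycle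
edge `e` changes `(#bad,#P1,#P2)` by `2·(#bad,#P1,#P2)(H − e)` (two-terminal substitution R0), and `H − e` is such a caterpillar.
[this work] (gen 63).
-/

namespace Summit.CriticalPhenomena.PercolationContinuityZ3.Theorems.ProductFormTightPieces

open Finset

variable {κ : Type*}

/-! ### 1. The gap polynomial of a vertex with tight children -/

/-- Auxiliary: `32∏(n+4x) − 27∏(n+3x) + ∏(n+x) ≥ 0` for `n, x ≥ 0`. [this work] -/
theorem gap_aux3 (s : Finset κ) (n x : κ → ℝ) (hn : ∀ u ∈ s, 0 ≤ n u) (hx : ∀ u ∈ s, 0 ≤ x u) :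
    0 ≤ 32 * ∏ u ∈ s, (n u + 4 * x u) - 27 * ∏ u ∈ s, (n u + 3 * x u) + ∏ u ∈ s, (n u + x u) := by
  have h1 : ∏ u ∈ s, (n u + 3 * x u) ≤ ∏ u ∈ s, (n u + 4 * x u) :=
    Finset.prod_le_prod (fun u hu => by have := hn u hu; have := hx u hu; linarith)
      (fun u hu => by have := hx u hu; linarith)
  have h2 : 0 ≤ ∏ u ∈ s, (n u + 3 * x u) := Finset.prod_nonneg fun u hu => by have := hn u hu; have := hx u hu; linarith
  have h3 : 0 ≤ ∏ u ∈ s, (n u + x u) := Finset.prod_nonneg fun u hu => by have := hn u hu; have := hx u hu; linarith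
  linarith

/-- Auxiliary: `8∏(n+4x) − 9∏(n+3x) + ∏(n+x) ≥ 0` for `n, x ≥ 0` (induction on the `Finset`). [this work] -/
theorem gap_aux2 [DecidableEq κ] (s : Finset κ) (n x : κ → ℝ) (hn : ∀ u ∈ s, 0 ≤ n u) (hx : ∀ u ∈ s, 0 ≤ x u) :
    0 ≤ 8 * ∏ u ∈ s, (n u + 4 * x u) - 9 * ∏ u ∈ s, (n u + 3 * x u) + ∏ u ∈ s, (n u + x u) := by
  induction s using Finset.induction_on with
  | empty => simp only [Finset.prod_empty]; norm_num
  | insert i s hi ih =>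
    have hn' : ∀ u ∈ s, 0 ≤ n u := fun u hu => hn u (Finset.mem_insert_of_mem hu)
    have hx' : ∀ u ∈ s, 0 ≤ x u := fun u hu => hx u (Finset.mem_insert_of_mem hu)
    have ih' := ih hn' hx'
    have h3 := gap_aux3 s n x hn' hx'
    have hni := hn i (Finset.mem_insert_self i s); have hxi := hx i (Finset.mem_insert_self i s)
    rw [Finset.prod_insert hi, Finset.prod_insert hi, Finset.prod_insert hi]
    set A := ∏ u ∈ s, (n u + 4 * x u); set B := ∏ u ∈ s, (n u + 3 * x u); set C := ∏ u ∈ s, (n u + x u)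
    have key : 8 * ((n i + 4 * x i) * A) - 9 * ((n i + 3 * x i) * B) + (n i + x i) * C
        = n i * (8 * A - 9 * B + C) + x i * (32 * A - 27 * B + C) := by ring
    rw [key]
    exact add_nonneg (mul_nonneg hni ih') (mul_nonneg hxi h3)

/-- Auxiliary: `2∏(n+4x) − 3∏(n+3x) + ∏(n+x) ≥ 0` for `n, x ≥ 0`. [this work] -/
theorem gap_aux1 [DecidableEq κ] (s : Finset κ) (n x : κ → ℝ) (hn : ∀ u ∈ s, 0 ≤ n u) (hx : ∀ u ∈ s, 0 ≤ x u) :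
    0 ≤ 2 * ∏ u ∈ s, (n u + 4 * x u) - 3 * ∏ u ∈ s, (n u + 3 * x u) + ∏ u ∈ s, (n u + x u) := by
  induction s using Finset.induction_on with
  | empty => simp only [Finset.prod_empty]; norm_num
  | insert i s hi ih =>
    have hn' : ∀ u ∈ s, 0 ≤ n u := fun u hu => hn u (Finset.mem_insert_of_mem hu)
    have hx' : ∀ u ∈ s, 0 ≤ x u := fun u hu => hx u (Finset.mem_insert_of_mem hu)
    have ih' := ih hn' hx'
    have h2 := gap_aux2 s n x hn' hx'
    have hni := hn i (Finset.mem_insert_self i s); have hxi := hx i (Finset.mem_insert_self i s)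
    rw [Finset.prod_insert hi, Finset.prod_insert hi, Finset.prod_insert hi]
    set A := ∏ u ∈ s, (n u + 4 * x u); set B := ∏ u ∈ s, (n u + 3 * x u); set C := ∏ u ∈ s, (n u + x u)
    have key : 2 * ((n i + 4 * x i) * A) - 3 * ((n i + 3 * x i) * B) + (n i + x i) * C
        = n i * (2 * A - 3 * B + C) + x i * (8 * A - 9 * B + C) := by ring
    rw [key]
    exact add_nonneg (mul_nonneg hni ih') (mul_nonneg hxi h2)

/-- **The gap polynomial is nonnegative**: `∏(n+4x) − 2∏(n+3x) + 2∏(n+x) − ∏ n ≥ 0` for `n_u, x_u ≥ 0` over any finite index set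
(`= ∑_{S≠∅}(4^{|S|} − 2·3^{|S|} + 2)∏_{S} x ∏_{Sᶜ} n`).  This is `#P1 − #bad` at an unmarked vertex with tight children. [this work] -/
theorem gap_prod_nonneg [DecidableEq κ] (s : Finset κ) (n x : κ → ℝ) (hn : ∀ u ∈ s, 0 ≤ n u) (hx : ∀ u ∈ s, 0 ≤ x u) :
    0 ≤ (∏ u ∈ s, (n u + 4 * x u)) - 2 * ∏ u ∈ s, (n u + 3 * x u) + 2 * ∏ u ∈ s, (n u + x u) - ∏ u ∈ s, n u := by
  induction s using Finset.induction_on with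
  | empty => simp only [Finset.prod_empty]; norm_num
  | insert i s hi ih =>
    have hn' : ∀ u ∈ s, 0 ≤ n u := fun u hu => hn u (Finset.mem_insert_of_mem hu)
    have hx' : ∀ u ∈ s, 0 ≤ x u := fun u hu => hx u (Finset.mem_insert_of_mem hu)
    have ih' := ih hn' hx'
    have h1 := gap_aux1 s n x hn' hx'
    have hni := hn i (Finset.mem_insert_self i s); have hxi := hx i (Finset.mem_insert_self i s)
    rw [Finset.prod_insert hi, Finset.prod_insert hi, Finset.prod_insert hi, Finset.prod_insert hi]
    set A := ∏ u ∈ s, (n u + 4 * x u); set B := ∏ u ∈ s, (n u + 3 * x u); set C := ∏ u ∈ s, (n u + x u)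
    set D := ∏ u ∈ s, n u
    have key : (n i + 4 * x i) * A - 2 * ((n i + 3 * x i) * B) + 2 * ((n i + x i) * C) - n i * D
        = n i * (A - 2 * B + 2 * C - D) + x i * (2 * (2 * A - 3 * B + C)) := by ring
    rw [key]
    exact add_nonneg (mul_nonneg hni ih') (mul_nonneg hxi (mul_nonneg (by norm_num) h1))

/-! ### 2. A vertex with tight children -/

/-- If every child is tight (`p = q = 2r − g`) then the unmarked parent has `p_v = q_v` (`#P1 = #P2`). [this work] -/
theorem tight_children_p_eq_q (s : Finset κ) (r p q : κ → ℝ) (hpq : ∀ u ∈ s, p u = q u) :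
    ∏ u ∈ s, (2 * p u + q u - r u) = ∏ u ∈ s, (p u + 2 * q u - r u) :=
  Finset.prod_congr rfl fun u hu => by rw [hpq u hu]; ring

/-- With tight children (`p = q = 2r − g`), in the variables `x = p − r`, `n = r + g`:
`#P1 − #bad = (p_v − r_v) − (r_v − g_v) = ∏(n+4x) − 2∏(n+3x) + 2∏(n+x) − ∏n`. [this work] -/
theorem tight_children_gap_eq (s : Finset κ) (r p q g : κ → ℝ) (hpq : ∀ u ∈ s, p u = q u)
    (ht : ∀ u ∈ s, p u = 2 * r u - g u) :
    ((∏ u ∈ s, (2 * p u + q u - r u)) - ∏ u ∈ s, (p u + q u))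
      - ((∏ u ∈ s, (p u + q u)) - ((∏ u ∈ s, (p u + g u)) + (∏ u ∈ s, (q u + g u)) - ∏ u ∈ s, (r u + g u)))
    = (∏ u ∈ s, ((r u + g u) + 4 * (p u - r u))) - 2 * ∏ u ∈ s, ((r u + g u) + 3 * (p u - r u))
      + 2 * ∏ u ∈ s, ((r u + g u) + (p u - r u)) - ∏ u ∈ s, (r u + g u) := by
  have e1 : ∏ u ∈ s, (2 * p u + q u - r u) = ∏ u ∈ s, ((r u + g u) + 4 * (p u - r u)) :=
    Finset.prod_congr rfl fun u hu => by rw [← hpq u hu]; have := ht u hu; linarith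
  have e2 : ∏ u ∈ s, (p u + q u) = ∏ u ∈ s, ((r u + g u) + 3 * (p u - r u)) :=
    Finset.prod_congr rfl fun u hu => by rw [← hpq u hu]; have := ht u hu; linarith
  have e3 : ∏ u ∈ s, (p u + g u) = ∏ u ∈ s, ((r u + g u) + (p u - r u)) :=
    Finset.prod_congr rfl fun u _ => by ring
  have e4 : ∏ u ∈ s, (q u + g u) = ∏ u ∈ s, ((r u + g u) + (p u - r u)) :=
    Finset.prod_congr rfl fun u hu => by rw [← hpq u hu]; ring
  rw [e1, e2, e3, e4]; ring

/-- **AM form at a vertex with tight children**: `#bad ≤ #P1 (= #P2)`, i.e. `r_v − g_v ≤ p_v − r_v`, whenever every child is tight with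
`r ≤ p` and `0 ≤ r + g`. [this work] -/
theorem tight_children_bad_le_P1 [DecidableEq κ] (s : Finset κ) (r p q g : κ → ℝ) (hpq : ∀ u ∈ s, p u = q u)
    (ht : ∀ u ∈ s, p u = 2 * r u - g u) (hrp : ∀ u ∈ s, r u ≤ p u) (hn : ∀ u ∈ s, 0 ≤ r u + g u) :
    (∏ u ∈ s, (p u + q u)) - ((∏ u ∈ s, (p u + g u)) + (∏ u ∈ s, (q u + g u)) - ∏ u ∈ s, (r u + g u))
      ≤ (∏ u ∈ s, (2 * p u + q u - r u)) - ∏ u ∈ s, (p u + q u) := by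
  have h := tight_children_gap_eq s r p q g hpq ht
  have hnn := gap_prod_nonneg s (fun u => r u + g u) (fun u => p u - r u) hn (fun u hu => by have := hrp u hu; linarith)
  linarith

/-- **Two tight children give a tight parent**: for `s = {u₁, u₂}` (or fewer) the gap polynomial vanishes identically, so
`p_v − r_v = r_v − g_v` (`#P1 = #bad`). [this work] -/
theorem tight_of_two_children [DecidableEq κ] (u₁ u₂ : κ) (r p q g : κ → ℝ) (hpq : ∀ u ∈ ({u₁, u₂} : Finset κ), p u = q u)
    (ht : ∀ u ∈ ({u₁, u₂} : Finset κ), p u = 2 * r u - g u) :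
    (∏ u ∈ ({u₁, u₂} : Finset κ), (2 * p u + q u - r u)) - ∏ u ∈ ({u₁, u₂} : Finset κ), (p u + q u)
      = (∏ u ∈ ({u₁, u₂} : Finset κ), (p u + q u))
        - ((∏ u ∈ ({u₁, u₂} : Finset κ), (p u + g u)) + (∏ u ∈ ({u₁, u₂} : Finset κ), (q u + g u))
          - ∏ u ∈ ({u₁, u₂} : Finset κ), (r u + g u)) := by
  have h := tight_children_gap_eq ({u₁, u₂} : Finset κ) r p q g hpq ht
  by_cases h12 : u₁ = u₂
  · subst h12
    have hs : ({u₁, u₁} : Finset κ) = {u₁} := Finset.insert_eq_of_mem (Finset.mem_singleton_self u₁)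
    rw [hs] at h ⊢
    simp only [Finset.prod_singleton] at h ⊢
    linear_combination h
  · simp only [Finset.prod_pair h12] at h ⊢
    linear_combination h

/-- One tight child gives a tight parent. [this work] -/
theorem tight_of_one_child (u₁ : κ) (r p q g : κ → ℝ) (hpq : p u₁ = q u₁) (ht : p u₁ = 2 * r u₁ - g u₁) :
    (∏ u ∈ ({u₁} : Finset κ), (2 * p u + q u - r u)) - ∏ u ∈ ({u₁} : Finset κ), (p u + q u)
      = (∏ u ∈ ({u₁} : Finset κ), (p u + q u))
        - ((∏ u ∈ ({u₁} : Finset κ), (p u + g u)) + (∏ u ∈ ({u₁} : Finset κ), (q u + g u))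
          - ∏ u ∈ ({u₁} : Finset κ), (r u + g u)) := by
  have h := tight_children_gap_eq ({u₁} : Finset κ) r p q g (fun u hu => by rw [Finset.mem_singleton.mp hu]; exact hpq)
    (fun u hu => by rw [Finset.mem_singleton.mp hu]; exact ht)
  simp only [Finset.prod_singleton] at h ⊢
  linear_combination h

/-! ### 3. Caterpillar recursions are tight -/

section Tree

variable {V : Type*} [DecidableEq V]

/-- **Hub caterpillars are tight.**  On a finite rooted forest (children `ch v`, height `ht` decreasing to children) let real `r,p,q,g` solve
the UNMARKED tree recursion, where every vertex has at most two children (`(ch v).card ≤ 2`) and every leaf (no children) carries tight data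
`p = q = 2r − g` — in the application the leaves are the pendant hubs `(1,2,2,0)` and bare tips `(1,1,1,1)`, the internal vertices are the
arm vertices (children: own hub and the rest of the arm) and the apex (children: the two arms).  Then `p_v = q_v = 2r_v − g_v` at EVERY
vertex: `#P1 = #P2 = #bad` for every sub-instance, in particular at the root. [this work] -/
theorem tight_of_caterpillarRecursion (ch : V → Finset V) (ht : V → ℕ) (hht : ∀ v, ∀ u ∈ ch v, ht u < ht v)
    (r p q g : V → ℝ) (hcard : ∀ v, (ch v).card ≤ 2)
    (hleaf : ∀ v, ch v = ∅ → p v = q v ∧ p v = 2 * r v - g v)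
    (hr : ∀ v, ch v ≠ ∅ → r v = ∏ u ∈ ch v, (p u + q u))
    (hp : ∀ v, ch v ≠ ∅ → p v = ∏ u ∈ ch v, (2 * p u + q u - r u))
    (hq : ∀ v, ch v ≠ ∅ → q v = ∏ u ∈ ch v, (p u + 2 * q u - r u))
    (hg : ∀ v, ch v ≠ ∅ → g v = (∏ u ∈ ch v, (p u + g u)) + (∏ u ∈ ch v, (q u + g u)) - ∏ u ∈ ch v, (r u + g u))
    (v : V) : p v = q v ∧ p v = 2 * r v - g v := by
  suffices H : ∀ N : ℕ, ∀ v, ht v ≤ N → p v = q v ∧ p v = 2 * r v - g v from H (ht v) v le_rfl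
  intro N
  induction N with
  | zero =>
    intro v hv
    have hch : ch v = ∅ := by
      rcases (ch v).eq_empty_or_nonempty with h | ⟨u, hu⟩
      · exact h
      · exact absurd (hht v u hu) (by omega)
    exact hleaf v hch
  | succ N ih =>
    intro v hv
    by_cases hch : ch v = ∅
    · exact hleaf v hch
    have IH : ∀ u ∈ ch v, p u = q u ∧ p u = 2 * r u - g u := fun u hu => ih u (by have := hht v u hu; omega)
    have hpq : ∀ u ∈ ch v, p u = q u := fun u hu => (IH u hu).1
    have htt : ∀ u ∈ ch v, p u = 2 * r u - g u := fun u hu => (IH u hu).2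
    have e1 : p v = q v := by rw [hp v hch, hq v hch]; exact tight_children_p_eq_q _ r p q hpq
    refine ⟨e1, ?_⟩
    -- the gap vanishes since there are at most two children
    have hgap : (∏ u ∈ ch v, (2 * p u + q u - r u)) - ∏ u ∈ ch v, (p u + q u)
        = (∏ u ∈ ch v, (p u + q u)) - ((∏ u ∈ ch v, (p u + g u)) + (∏ u ∈ ch v, (q u + g u))
          - ∏ u ∈ ch v, (r u + g u)) := by
      have hpos : 0 < (ch v).card := Finset.card_pos.mpr (Finset.nonempty_iff_ne_empty.mpr hch)
      have hc12 : (ch v).card = 1 ∨ (ch v).card = 2 := by have := hcard v; omega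
      rcases hc12 with hc1 | hc2
      · obtain ⟨u₁, hs⟩ := Finset.card_eq_one.mp hc1
        have hu₁ : u₁ ∈ ch v := by rw [hs]; exact Finset.mem_singleton_self u₁
        rw [hs]
        exact tight_of_one_child u₁ r p q g (hpq u₁ hu₁) (htt u₁ hu₁)
      · obtain ⟨a, b, hab, hs⟩ := Finset.card_eq_two.mp hc2
        rw [hs]
        have hpq' : ∀ u ∈ ({a, b} : Finset V), p u = q u := fun u hu => hpq u (hs ▸ hu)
        have htt' : ∀ u ∈ ({a, b} : Finset V), p u = 2 * r u - g u := fun u hu => htt u (hs ▸ hu)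
        exact tight_of_two_children a b r p q g hpq' htt'
    rw [hp v hch, hr v hch, hg v hch]
    linarith [hgap]

end Tree

end Summit.CriticalPhenomena.PercolationContinuityZ3.Theorems.ProductFormTightPieces

/-! ### 4. Appendix (gen 63, second submission): the exact gap for three children; erratum

Erratum to the file header: the coefficient list of the gap polynomial `∑_{S≠∅}(4^{|S|} − 2·3^{|S|} + 2)∏_S x ∏_{Sᶜ} n` reads
`0, 0, 12, 96, 540, …` (`= 4^j − 2·3^j + 2` for `|S| = j = 1, 2, 3, 4, 5, …`), not `0, 0, 12, 110, …`.  Statements are unaffected. -/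

namespace Summit.CriticalPhenomena.PercolationContinuityZ3.Theorems.ProductFormTightPieces

/-- **Three tight children: the gap is exactly `12·x₁x₂x₃`.**  For three distinct children with tight data (`p = q = 2r − g`), in the
variables `x = p − r`, `n = r + g`:  `#P1 − #bad = ∏(n+4x) − 2∏(n+3x) + 2∏(n+x) − ∏n = 12·x₁·x₂·x₃` — the first non-vanishing case of
the gap polynomial (e.g. the apex with three pendant hubs: `#P1 − #bad = 331 − 319 = 12`). [this work] -/
theorem gap_of_three_children {κ : Type*} [DecidableEq κ] (u₁ u₂ u₃ : κ) (h12 : u₁ ≠ u₂) (h13 : u₁ ≠ u₃) (h23 : u₂ ≠ u₃)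
    (n x : κ → ℝ) :
    (∏ u ∈ ({u₁, u₂, u₃} : Finset κ), (n u + 4 * x u)) - 2 * ∏ u ∈ ({u₁, u₂, u₃} : Finset κ), (n u + 3 * x u)
      + 2 * ∏ u ∈ ({u₁, u₂, u₃} : Finset κ), (n u + x u) - ∏ u ∈ ({u₁, u₂, u₃} : Finset κ), n u
    = 12 * (x u₁ * x u₂ * x u₃) := by
  have h1 : u₁ ∉ ({u₂, u₃} : Finset κ) := by
    simp only [Finset.mem_insert, Finset.mem_singleton, not_or]; exact ⟨h12, h13⟩
  rw [Finset.prod_insert h1, Finset.prod_insert h1, Finset.prod_insert h1, Finset.prod_insert h1,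
    Finset.prod_pair h23, Finset.prod_pair h23, Finset.prod_pair h23, Finset.prod_pair h23]
  ring

/-- With three tight children the parent's `#P1 − #bad` equals `12·x₁x₂x₃` (recursion variables). [this work] -/
theorem tight_three_children_gap {κ : Type*} [DecidableEq κ] (u₁ u₂ u₃ : κ) (h12 : u₁ ≠ u₂) (h13 : u₁ ≠ u₃) (h23 : u₂ ≠ u₃)
    (r p q g : κ → ℝ) (hpq : ∀ u ∈ ({u₁, u₂, u₃} : Finset κ), p u = q u)
    (ht : ∀ u ∈ ({u₁, u₂, u₃} : Finset κ), p u = 2 * r u - g u) :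
    ((∏ u ∈ ({u₁, u₂, u₃} : Finset κ), (2 * p u + q u - r u)) - ∏ u ∈ ({u₁, u₂, u₃} : Finset κ), (p u + q u))
      - ((∏ u ∈ ({u₁, u₂, u₃} : Finset κ), (p u + q u))
          - ((∏ u ∈ ({u₁, u₂, u₃} : Finset κ), (p u + g u)) + (∏ u ∈ ({u₁, u₂, u₃} : Finset κ), (q u + g u))
              - ∏ u ∈ ({u₁, u₂, u₃} : Finset κ), (r u + g u)))
    = 12 * ((p u₁ - r u₁) * (p u₂ - r u₂) * (p u₃ - r u₃)) := by
  rw [tight_children_gap_eq _ r p q g hpq ht]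
  exact gap_of_three_children u₁ u₂ u₃ h12 h13 h23 (fun u => r u + g u) (fun u => p u - r u)

end Summit.CriticalPhenomena.PercolationContinuityZ3.Theorems.ProductFormTightPieces
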